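import Mathlib.Geometry.Manifold.ContMDiffMFDeriv
import Mathlib.Geometry.Manifold.MFDeriv.Tangent
import Mathlib.Analysis.Calculus.ContDiff.Operations
import Mathlib.Geometry.Manifold.LocalDiffeomorph
import Summits.SmoothPoincare4.SmoothPoincare4.Theses.SullivanDual
import Literature.Geometry.Symplectic.GromovR4StdModel
import Literature.Geometry.Symplectic.GromovMcDuffChartFormProofs
import Literature.Geometry.Symplectic.SteinBall
import HarnessLib

/-!
# Route SullivanDual, support item `AdmissibleJExists` (stmt-SmoothPoincare4-7830):
# pulled-back almost complex structures standard near the puncture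

Problem `SmoothPoincare4`, route `SullivanDual`, support item stmt-SmoothPoincare4-7830
`AdmissibleJExists`: every punctured homotopy 4-sphere `Σ ∖ p` carries a smooth `J`, `J² = -1`,
which on some punctured `ε'`-chart-ball at `p` (closed ball inside the chart target) is STANDARD,
`⟪A (J v), b⟫ = ω₀(A v, b)` with `A = Dι(e x − e p) ∘ De_x`, i.e. `J = (ι ∘ (e − e p))^* J₀` there.

This file PROVES the construction half and the standard-sphere case:

* §1–2 (general, any `C^∞` manifold `N` modelled on a complete normed space): conjugating a fixed
  `j : F → F` by a coframe `Ψ_x : T_x N → F` gives `J_x = Ψ_x⁻¹ j Ψ_x`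
  (`ContinuousLinearMap.inverse`); `J² = -1` where `Ψ_x` is invertible and `j² = -1`
  (`conj_conj`), and `J` read in tangent coordinates at `x₀` (`inTangentCoordinates`, exactly the
  smoothness clause of the route items) is `C^∞` at `x₀` as soon as the coframe read in the chart
  at `x₀` is `C^∞` there and `Ψ_{x₀}` is invertible (`contMDiffAt_inTangentCoordinates_conj`:
  cocycle rule for the tangent coordinate changes, smoothness of inversion of continuous linear
  maps at an invertible map, `contDiffAt_map_inverse`). For `Ψ = dΦ`, `Φ : N → F` smooth, the
  hypothesis is Mathlib's `ContMDiffAt.mfderiv_const`.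
* §3 (a `C^∞` 4-manifold `M`, `p ∈ M`): for `Φ : M ∖ {p} → ℝ⁴` smooth with invertible
  differentials which agrees with the inverted recentred chart `ι ∘ (e − e p)` on a punctured
  chart-ball (`AgreesWithInvertedChartNear`), `J = (dΦ)⁻¹ J₀ dΦ` satisfies the five clauses of
  `AdmissibleJExists` for `(M, p)` (`exists_admissibleJ_of_agreesWithInvertedChartNear`; on the
  ball `dΦ = Dι ∘ De` by the chain rule `hasMFDerivAt_inversion_extChartAt_sub` of
  `GromovR4StdModel.lean`, and `⟪J₀ a, b⟫ = ω₀(a, b)`).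
* §4: for every homotopy 4-sphere DIFFEOMORPHIC TO `S⁴` and every point, the tree's proved chart
  form of Palais' disc theorem (`palais_puncturedSphere_chartForm_holds`) supplies such a `Φ`
  (a diffeomorphism `Σ ∖ p ≃ₘ ℝ⁴`), whence the clauses of `AdmissibleJExists` at `(Σ, p)`
  (`admissibleJ_of_nonempty_diffeomorph_sphere`) and `AdmissibleJExists` from "every homotopy
  4-sphere is diffeomorphic to `S⁴`" (`admissibleJExists_of_forall_nonempty_diffeomorph_sphere`):
  the object class of the cruxes `HyperbolicEnd` / `WitnessCharge` is non-vacuous.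

NOT here: the general case (arbitrary homotopy 4-sphere), which is the obstruction-theoretic
statement that the tangent bundle of `Σ` has the clutching class of `TS⁴` (Euler number `2`,
`p₁ = 0` by Kervaire–Milnor's Thm. 3.1 / the signature theorem, Dold–Whitney); see the seat notes.

References: Gromov 1985 §0.3.C (standard ends); Palais 1960 Thm. B; McDuff–Salamon 2017
Rem. 4.5.2 (viii).
-/

-- the registered namespace `Summit.SmoothPoincare4.SmoothPoincare4.Theorems` repeats a component
set_option linter.dupNamespace false

open scoped Manifold ContDiff Topology
open Set Function ContinuousLinearMap

namespace Summit.SmoothPoincare4.SmoothPoincare4.Theorems.SullivanDual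

/-! ### §1 Conjugating `j` by a coframe: algebra -/

section Coframe

variable {E : Type*} [NormedAddCommGroup E] [NormedSpace ℝ E]
  {F : Type*} [NormedAddCommGroup F] [NormedSpace ℝ F]

/-- `Ψ (Ψ⁻¹ j Ψ v) = j (Ψ v)` for invertible `Ψ`. [folklore] -/
theorem apply_conj {j : F →L[ℝ] F} {Ψ : E →L[ℝ] F} (hΨ : Ψ.IsInvertible) (v : E) :
    Ψ ((Ψ.inverse ∘L j ∘L Ψ) v) = j (Ψ v) := by
  simp only [ContinuousLinearMap.coe_comp, Function.comp_apply, hΨ.self_apply_inverse]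

/-- If `j² = -1` and `Ψ` is invertible then `(Ψ⁻¹ j Ψ)² = -1`. [folklore] -/
theorem conj_conj {j : F →L[ℝ] F} (hj : ∀ w, j (j w) = -w) {Ψ : E →L[ℝ] F}
    (hΨ : Ψ.IsInvertible) (v : E) :
    (Ψ.inverse ∘L j ∘L Ψ) ((Ψ.inverse ∘L j ∘L Ψ) v) = -v := by
  have h := apply_conj (j := j) hΨ v
  simp only [ContinuousLinearMap.coe_comp, Function.comp_apply] at h ⊢
  rw [h, hj, map_neg, hΨ.inverse_apply_self]

/-- Conjugation is natural under an invertible change of frame on the source side: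
`(Ψ ∘ e)⁻¹ j (Ψ ∘ e) = e⁻¹ (Ψ⁻¹ j Ψ) e`. [folklore] -/
theorem conj_comp_equiv (j : F →L[ℝ] F) (Ψ : E →L[ℝ] F) (e : E ≃L[ℝ] E) :
    (Ψ ∘L (e : E →L[ℝ] E)).inverse ∘L j ∘L (Ψ ∘L (e : E →L[ℝ] E)) =
      (e.symm : E →L[ℝ] E) ∘L (Ψ.inverse ∘L j ∘L Ψ) ∘L (e : E →L[ℝ] E) := by
  simp only [inverse_comp_equiv]
  ext v
  rfl

end Coframe

/-! ### §2 Smoothness of the conjugated structure in tangent coordinates -/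

section Smooth

variable {EN : Type*} [NormedAddCommGroup EN] [NormedSpace ℝ EN] [CompleteSpace EN]
  {HN : Type*} [TopologicalSpace HN] {I : ModelWithCorners ℝ EN HN}
  {N : Type*} [TopologicalSpace N] [ChartedSpace HN N] [IsManifold I ∞ N]
  {F : Type*} [NormedAddCommGroup F] [NormedSpace ℝ F]

/-- **Smoothness of the conjugated structure.** Let `Ψ_x : T_x N → F` be a coframe and
`j : F → F`. If `Ψ` read in the tangent coordinates at `x₀` (`inTangentCoordinates I 𝓘(ℝ, F)`,
along any map `g` — the trivialisations of `TF` are the identity) is `C^∞` at `x₀` and `Ψ_{x₀}`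
is invertible, then `x ↦ Ψ_x⁻¹ j Ψ_x` read in tangent coordinates at `x₀` is `C^∞` at `x₀`.
Proof: on the chart domain of `x₀` both readings are conjugates by the tangent coordinate change
`x₀ → x`, an isomorphism with inverse the change `x → x₀` (cocycle rule), so the second is
`G(x)⁻¹ j G(x)` for the first `G`; inversion of continuous linear maps is smooth at the
invertible `G(x₀) = Ψ_{x₀}` (`contDiffAt_map_inverse`). [folklore] -/
theorem contMDiffAt_inTangentCoordinates_conj (j : F →L[ℝ] F)
    (Ψ : N → EN →L[ℝ] F) (g : N → F) {x₀ : N}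
    (hΨ : ContMDiffAt I 𝓘(ℝ, EN →L[ℝ] F) ∞
      (inTangentCoordinates I 𝓘(ℝ, F) (id : N → N) g Ψ x₀) x₀)
    (hinv : (Ψ x₀).IsInvertible) :
    ContMDiffAt I 𝓘(ℝ, EN →L[ℝ] EN) ∞
      (inTangentCoordinates I I (id : N → N) id
        (fun x => (Ψ x).inverse ∘L j ∘L Ψ x) x₀) x₀ := by
  set G : N → EN →L[ℝ] F := inTangentCoordinates I 𝓘(ℝ, F) (id : N → N) g Ψ x₀ with hG
  -- `G x = Ψ x ∘ (coordinate change x₀ → x)` on the chart domain of `x₀`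
  have hGeq : ∀ x, x ∈ (chartAt HN x₀).source →
      G x = Ψ x ∘L tangentCoordChange I x₀ x x := by
    intro x hx
    rw [hG, inTangentCoordinates_eq _ _ _ hx (by simp), tangentBundleCore_coordChange_model_space,
      ContinuousLinearMap.id_comp]
    rfl
  have hG0 : G x₀ = Ψ x₀ := by
    rw [hGeq x₀ (mem_chart_source HN x₀)]
    ext v
    simp only [ContinuousLinearMap.coe_comp, Function.comp_apply]
    rw [tangentCoordChange_self (mem_extChartAt_source x₀)]
  obtain ⟨e₀, he₀⟩ : (G x₀).IsInvertible := hG0 ▸ hinv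
  have hInv : ContMDiffAt I 𝓘(ℝ, F →L[ℝ] EN) ∞ (fun x => (G x).inverse) x₀ := by
    have h1 : ContDiffAt ℝ ∞ ContinuousLinearMap.inverse (G x₀) := by
      rw [← he₀]; exact contDiffAt_map_inverse e₀
    exact h1.comp_contMDiffAt hΨ
  have hcomp : ContMDiffAt I 𝓘(ℝ, EN →L[ℝ] EN) ∞ (fun x => (G x).inverse ∘L (j ∘L G x)) x₀ :=
    ContMDiffAt.clm_comp hInv (ContMDiffAt.clm_comp contMDiffAt_const hΨ)
  refine hcomp.congr_of_eventuallyEq ?_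
  filter_upwards [(chartAt HN x₀).open_source.mem_nhds (mem_chart_source HN x₀)] with x hx
  have hx' : x ∈ (extChartAt I x₀).source := by rwa [extChartAt_source]
  -- the coordinate changes `x₀ → x` and `x → x₀` at `x` are inverse isomorphisms
  let e : EN ≃L[ℝ] EN :=
    ContinuousLinearEquiv.equivOfInverse' (tangentCoordChange I x₀ x x) (tangentCoordChange I x x₀ x)
      (by
        ext v
        have h3 : x ∈ (extChartAt I x).source ∩ (extChartAt I x₀).source ∩
            (extChartAt I x).source := ⟨⟨mem_extChartAt_source x, hx'⟩, mem_extChartAt_source x⟩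
        simp only [ContinuousLinearMap.coe_comp, Function.comp_apply]
        rw [tangentCoordChange_comp h3, tangentCoordChange_self (mem_extChartAt_source x)]
        rfl)
      (by
        ext v
        have h3 : x ∈ (extChartAt I x₀).source ∩ (extChartAt I x).source ∩
            (extChartAt I x₀).source := ⟨⟨hx', mem_extChartAt_source x⟩, hx'⟩
        simp only [ContinuousLinearMap.coe_comp, Function.comp_apply]
        rw [tangentCoordChange_comp h3, tangentCoordChange_self hx']
        rfl)
  have he : (e : EN →L[ℝ] EN) = tangentCoordChange I x₀ x x := rfl
  have hes : (e.symm : EN →L[ℝ] EN) = tangentCoordChange I x x₀ x := rfl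
  rw [inTangentCoordinates_eq _ _ _ hx hx, hGeq x hx, ← he, conj_comp_equiv, hes, he]
  rfl

end Smooth

/-! ### §3 The pulled-back structure on a punctured `4`-manifold, standard near the puncture -/

section Punctured

open Literature.Geometry.Symplectic

/-- `⟪J₀ a, b⟫ = ω₀(a, b)`: the standard complex structure and the standard symplectic form of
`ℝ⁴ = ℂ²` are related by the Euclidean metric. [folklore] -/
theorem inner_stdComplexStructure_eq_stdSymplecticForm (a b : EuclideanSpace ℝ (Fin 4)) :
    inner ℝ (stdComplexStructure a) b = stdSymplecticForm a b := by
  rw [Literature.Topology.FourManifolds.inner_fin_four]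
  simp only [stdComplexStructure_apply_zero, stdComplexStructure_apply_one,
    stdComplexStructure_apply_two, stdComplexStructure_apply_three, stdSymplecticForm]
  ring

variable {M : Type*} [TopologicalSpace M] [T2Space M] [ChartedSpace (EuclideanSpace ℝ (Fin 4)) M]
  [IsManifold (𝓡 4) ∞ M]

/-- **An equidimensional immersion standard near the puncture gives an admissible `J`.** Let
`Φ : M ∖ {p} → ℝ⁴` be `C^∞` with everywhere invertible differential, agreeing with the inverted
recentred chart `ι ∘ (e − e p)` on some punctured chart-ball at `p`. Then
`J_x = (dΦ_x)⁻¹ ∘ J₀ ∘ dΦ_x` (`= Φ^* J₀`, read in the preferred chart at `x` as Mathlib does) is a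
smooth almost complex structure on `M ∖ {p}` which is standard — `⟪A (J v), b⟫ = ω₀(A v, b)`,
`A = Dι(e x − e p) ∘ De_x` — on a punctured chart-ball of radius `ε' > 0` whose closure lies in
the chart target: the five clauses of `AdmissibleJExists` for `(M, p)`. On the ball `dΦ_x = A`
by the chain rule (`hasMFDerivAt_inversion_extChartAt_sub`), so `A (J v) = J₀ (A v)` and
`⟪J₀ a, b⟫ = ω₀(a, b)`. [folklore] -/
theorem exists_admissibleJ_of_agreesWithInvertedChartNear (p : M)
    (Φ : punctured p → EuclideanSpace ℝ (Fin 4))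
    (hΦ : ContMDiff (𝓡 4) 𝓘(ℝ, EuclideanSpace ℝ (Fin 4)) ∞ Φ)
    (hinv : ∀ x, (mfderiv (𝓡 4) 𝓘(ℝ, EuclideanSpace ℝ (Fin 4)) Φ x).IsInvertible)
    (hagree : AgreesWithInvertedChartNear p Φ) :
    ∃ (J : ∀ x : punctured p, TangentSpace (𝓡 4) x →L[ℝ] TangentSpace (𝓡 4) x) (ε' : ℝ),
      0 < ε' ∧ Metric.closedBall (extChartAt (𝓡 4) p p) ε' ⊆ (extChartAt (𝓡 4) p).target ∧
      (∀ (x : punctured p) (v : TangentSpace (𝓡 4) x), J x (J x v) = -v) ∧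
      (∀ x₀ : punctured p, ContMDiffAt (𝓡 4)
        𝓘(ℝ, EuclideanSpace ℝ (Fin 4) →L[ℝ] EuclideanSpace ℝ (Fin 4)) ∞
        (inTangentCoordinates (𝓡 4) (𝓡 4) (id : punctured p → punctured p) id
          (fun x => J x) x₀) x₀) ∧
      (∀ x : punctured p, InPuncturedChartBall p ε' x →
        ∀ (v : TangentSpace (𝓡 4) x) (b : EuclideanSpace ℝ (Fin 4)),
        inner ℝ (fderiv ℝ inversion (extChartAt (𝓡 4) p x.1 - extChartAt (𝓡 4) p p)
          (mfderiv (𝓡 4) 𝓘(ℝ, EuclideanSpace ℝ (Fin 4))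
            (fun z : punctured p => extChartAt (𝓡 4) p z.1) x (J x v))) b =
        stdSymplecticForm (fderiv ℝ inversion (extChartAt (𝓡 4) p x.1 - extChartAt (𝓡 4) p p)
          (mfderiv (𝓡 4) 𝓘(ℝ, EuclideanSpace ℝ (Fin 4))
            (fun z : punctured p => extChartAt (𝓡 4) p z.1) x v)) b) := by
  obtain ⟨ε, hε, hagree⟩ := hagree
  -- a closed chart-ball inside the chart target
  obtain ⟨r, hr, hball⟩ : ∃ r > (0 : ℝ),
      Metric.closedBall (extChartAt (𝓡 4) p p) r ⊆ (extChartAt (𝓡 4) p).target := by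
    obtain ⟨r, hr, h⟩ := Metric.isOpen_iff.mp (isOpen_extChartAt_target (I := 𝓡 4) p)
      (extChartAt (𝓡 4) p p) (mem_extChartAt_target (I := 𝓡 4) p)
    exact ⟨r / 2, half_pos hr, (Metric.closedBall_subset_ball (half_lt_self hr)).trans h⟩
  -- the coframe `Ψ = dΦ` (with `T_x` and `T_{Φ x} ℝ⁴` read as `ℝ⁴`) and `J = Ψ⁻¹ J₀ Ψ`
  let Ψ : punctured p → EuclideanSpace ℝ (Fin 4) →L[ℝ] EuclideanSpace ℝ (Fin 4) :=
    fun x => mfderiv (𝓡 4) 𝓘(ℝ, EuclideanSpace ℝ (Fin 4)) Φ x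
  have hinv' : ∀ x, (Ψ x).IsInvertible := fun x => hinv x
  have hΨ : ∀ x₀ : punctured p, ContMDiffAt (𝓡 4)
      𝓘(ℝ, EuclideanSpace ℝ (Fin 4) →L[ℝ] EuclideanSpace ℝ (Fin 4)) ∞
      (inTangentCoordinates (𝓡 4) 𝓘(ℝ, EuclideanSpace ℝ (Fin 4)) (id : punctured p → punctured p)
        Φ Ψ x₀) x₀ :=
    fun x₀ => ContMDiffAt.mfderiv_const (hΦ x₀) (by simp)
  let J : punctured p → EuclideanSpace ℝ (Fin 4) →L[ℝ] EuclideanSpace ℝ (Fin 4) :=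
    fun x => (Ψ x).inverse ∘L stdComplexStructure ∘L Ψ x
  refine ⟨fun x => J x, min ε r, lt_min hε hr,
    (Metric.closedBall_subset_closedBall (min_le_right ε r)).trans hball,
    fun x v => conj_conj stdComplexStructure_sq (hinv' x) v,
    fun x₀ => contMDiffAt_inTangentCoordinates_conj stdComplexStructure Ψ Φ (hΨ x₀) (hinv' x₀),
    ?_⟩
  intro x hx v b
  -- on the punctured ball `Φ` is the inverted chart, so `dΦ_x = Dι(e x − e p) ∘ De_x`
  have hev : Φ =ᶠ[𝓝 x]
      fun z : punctured p => inversion (extChartAt (𝓡 4) p z.1 - extChartAt (𝓡 4) p p) :=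
    Filter.eventuallyEq_of_mem ((isOpen_setOf_inPuncturedChartBall p (min ε r)).mem_nhds hx)
      fun z hz => hagree z hz.1 (Metric.ball_subset_ball (min_le_left ε r) hz.2)
  have hA : Ψ x = (fderiv ℝ inversion (extChartAt (𝓡 4) p x.1 - extChartAt (𝓡 4) p p)).comp
      (mfderiv (𝓡 4) 𝓘(ℝ, EuclideanSpace ℝ (Fin 4))
        (fun z : punctured p => extChartAt (𝓡 4) p z.1) x) :=
    ((hasMFDerivAt_inversion_extChartAt_sub p x hx.1).congr_of_eventuallyEq hev).mfderiv
  have hAw : ∀ w : EuclideanSpace ℝ (Fin 4),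
      fderiv ℝ inversion (extChartAt (𝓡 4) p x.1 - extChartAt (𝓡 4) p p)
        (mfderiv (𝓡 4) 𝓘(ℝ, EuclideanSpace ℝ (Fin 4))
          (fun z : punctured p => extChartAt (𝓡 4) p z.1) x w) = Ψ x w :=
    fun w => by rw [hA]; rfl
  simp only [hAw]
  erw [apply_conj (hinv' x) v]
  rw [inner_stdComplexStructure_eq_stdSymplecticForm]

/-- The same for a **diffeomorphism** `Φ : M ∖ {p} ≃ₘ ℝ⁴` agreeing with the inverted chart near
`p` (its differentials are invertible, `Diffeomorph.mfderivToContinuousLinearEquiv`). [folklore] -/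
theorem exists_admissibleJ_of_diffeomorph (p : M)
    (Φ : (punctured p) ≃ₘ⟮𝓡 4, 𝓡 4⟯ EuclideanSpace ℝ (Fin 4))
    (hagree : AgreesWithInvertedChartNear p Φ) :
    ∃ (J : ∀ x : punctured p, TangentSpace (𝓡 4) x →L[ℝ] TangentSpace (𝓡 4) x) (ε' : ℝ),
      0 < ε' ∧ Metric.closedBall (extChartAt (𝓡 4) p p) ε' ⊆ (extChartAt (𝓡 4) p).target ∧
      (∀ (x : punctured p) (v : TangentSpace (𝓡 4) x), J x (J x v) = -v) ∧
      (∀ x₀ : punctured p, ContMDiffAt (𝓡 4)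
        𝓘(ℝ, EuclideanSpace ℝ (Fin 4) →L[ℝ] EuclideanSpace ℝ (Fin 4)) ∞
        (inTangentCoordinates (𝓡 4) (𝓡 4) (id : punctured p → punctured p) id
          (fun x => J x) x₀) x₀) ∧
      (∀ x : punctured p, InPuncturedChartBall p ε' x →
        ∀ (v : TangentSpace (𝓡 4) x) (b : EuclideanSpace ℝ (Fin 4)),
        inner ℝ (fderiv ℝ inversion (extChartAt (𝓡 4) p x.1 - extChartAt (𝓡 4) p p)
          (mfderiv (𝓡 4) 𝓘(ℝ, EuclideanSpace ℝ (Fin 4))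
            (fun z : punctured p => extChartAt (𝓡 4) p z.1) x (J x v))) b =
        stdSymplecticForm (fderiv ℝ inversion (extChartAt (𝓡 4) p x.1 - extChartAt (𝓡 4) p p)
          (mfderiv (𝓡 4) 𝓘(ℝ, EuclideanSpace ℝ (Fin 4))
            (fun z : punctured p => extChartAt (𝓡 4) p z.1) x v)) b) :=
  exists_admissibleJ_of_agreesWithInvertedChartNear p Φ Φ.contMDiff
    (fun x => ⟨Φ.mfderivToContinuousLinearEquiv (by simp) x,
      Φ.mfderivToContinuousLinearEquiv_coe (by simp)⟩) hagree

end Punctured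

/-! ### §4 The standard sphere: `AdmissibleJExists` holds for every `Σ ≅ S⁴` -/

section Sphere

open Literature.Geometry.Symplectic Literature.Topology.FourManifolds

/-- **Every homotopy `4`-sphere diffeomorphic to `S⁴` carries an admissible `J` at every point**
(the clauses of `AdmissibleJExists` for `(Σ, p)`): Palais' chart form
(`palais_puncturedSphere_chartForm_holds`, PROVED in the tree) gives `Φ : Σ ∖ {p} ≃ₘ ℝ⁴` agreeing
with the inverted chart near `p`, and `J = Φ^* J₀`. In particular the object class posited by the
cruxes `HyperbolicEnd` / `WitnessCharge` of route SullivanDual is non-vacuous. [folklore] -/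
theorem admissibleJ_of_nonempty_diffeomorph_sphere (S : HomotopySphere 4) (p : S.carrier)
    (hS : Nonempty (S.carrier ≃ₘ⟮𝓡 4, 𝓡 4⟯ Metric.sphere (0 : EuclideanSpace ℝ (Fin 5)) 1)) :
    ∃ (J : ∀ x : punctured p, TangentSpace (𝓡 4) x →L[ℝ] TangentSpace (𝓡 4) x) (ε' : ℝ),
      0 < ε' ∧ Metric.closedBall (extChartAt (𝓡 4) p p) ε' ⊆ (extChartAt (𝓡 4) p).target ∧
      (∀ (x : punctured p) (v : TangentSpace (𝓡 4) x), J x (J x v) = -v) ∧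
      (∀ x₀ : punctured p, ContMDiffAt (𝓡 4) 𝓘(ℝ, EuclideanSpace ℝ (Fin 4) →L[ℝ]
          EuclideanSpace ℝ (Fin 4)) ∞
        (inTangentCoordinates (𝓡 4) (𝓡 4) (id : punctured p → punctured p) id
          (fun x => J x) x₀) x₀) ∧
      (∀ x : punctured p, InPuncturedChartBall p ε' x → ∀ (v : TangentSpace (𝓡 4) x)
          (b : EuclideanSpace ℝ (Fin 4)),
        inner ℝ (fderiv ℝ inversion (extChartAt (𝓡 4) p x.1 - extChartAt (𝓡 4) p p)
          (mfderiv (𝓡 4) 𝓘(ℝ, EuclideanSpace ℝ (Fin 4))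
            (fun z : punctured p => extChartAt (𝓡 4) p z.1) x (J x v))) b =
        stdSymplecticForm (fderiv ℝ inversion (extChartAt (𝓡 4) p x.1 - extChartAt (𝓡 4) p p)
          (mfderiv (𝓡 4) 𝓘(ℝ, EuclideanSpace ℝ (Fin 4))
            (fun z : punctured p => extChartAt (𝓡 4) p z.1) x v)) b) := by
  obtain ⟨Φ, hΦ⟩ := palais_puncturedSphere_chartForm_holds S.carrier p hS
  exact exists_admissibleJ_of_diffeomorph p Φ hΦ

/-- **`AdmissibleJExists` follows from the smooth Poincaré conjecture in homotopy-sphere form**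
(every homotopy `4`-sphere is diffeomorphic to `S⁴`): the consistency / non-vacuity direction of
the support item. [folklore] -/
theorem admissibleJExists_of_forall_nonempty_diffeomorph_sphere
    (h : ∀ S : HomotopySphere 4,
      Nonempty (S.carrier ≃ₘ⟮𝓡 4, 𝓡 4⟯ Metric.sphere (0 : EuclideanSpace ℝ (Fin 5)) 1)) :
    Theses.SullivanDual.AdmissibleJExists :=
  fun S p => admissibleJ_of_nonempty_diffeomorph_sphere S p (h S)

end Sphere

end Summit.SmoothPoincare4.SmoothPoincare4.Theorems.SullivanDual
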